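import Mathlib
import Literature.NumberTheory.Sieve.ParityWave0MPZDenseDivisibility
import HarnessLib

/-!
# DHL[42,2] certificate — Section 3: Proposition 3.3 and the chain criterion (Lemma 3.1)

Pure arithmetic of [Polymath 8a, Definition 2.1] `i`-tuply `y`-dense divisibility, stated over the
tree's `Literature.NumberTheory.Sieve.DenselyDivisible`: §0 the bridging iff
`denselyDivisible_succ_iff'` (clause order); §1 the degenerate case `n = 0` (`n = 1` is the tree's
`denselyDivisible_one`); §2 the extension step `(E_l)` of the proof of Proposition 3.3
(`denselyDivisible_mul_of_extension`, strong induction on `l`); §3 Proposition 3.3 for finite sets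
of factors and for squarefree `n` (`denselyDivisible_prod_of_chain`, `denselyDivisible_of_chain`),
the necessity half `chain_of_denselyDivisible_one` and **Lemma 3.1**
`denselyDivisible_one_iff_chain` (`n ∈ 𝒟^{(1)}(y)` iff `p_j ≤ y p_1 ⋯ p_{j−1}`). NOT here: the
multiset language `B_V`, `U_V`, `𝒞_i(c;β)`, refinements, Lemma 3.2 and the logarithmic dictionary (→
`Dhl42ChainCondC`).

Origin: `Dhl42/ChainCriterion.lean` of the DHL[42,2] certificate package (pub-dhl42 bundle, archive
blob `18cce9e3`; sha256[:16] of the file `bb6c947b32a20c2a`; paper snapshot = `paper/main.tex` v1),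
lines :40–:264; statements and proofs unchanged except: namespace `TpY4Dhl42` →
`Summit.Parity.GeneralizedHardyLittlewood.Theorems.Dhl42`, the package's `simplexSet n B` replaced
by the tree's definitionally equal `Literature.NumberTheory.Sieve.scaledSimplex n B` (also inside
declaration names), docstrings added where missing, `#print axioms` lines dropped; the package's
`DenselyDivisible` (same recursion, other conjunct order) replaced by the tree's: the four
unfoldings `rw [DenselyDivisible]` (:47 :91 :235; :60 dropped) now rewrite with
`denselyDivisible_succ_iff'` (§0, new, 14 lines), `denselyDivisible_one_right` (:52–:65) dropped for
the tree's `denselyDivisible_one` (use site :176). Package-internal references in the verbatim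
docstrings (`Dhl42/….lean`, `Assumed.…`, `row 9…`, `gen n`, `inputs/COMPARE.md`) refer to that
package (paper Appendix B).

Declarations (7): `denselyDivisible_succ_iff'`, `denselyDivisible_zero_right`,
`denselyDivisible_mul_of_extension`, `denselyDivisible_prod_of_chain`, `denselyDivisible_of_chain`,
`chain_of_denselyDivisible_one`, `denselyDivisible_one_iff_chain`.
-/

open Literature.NumberTheory.Sieve (DenselyDivisible denselyDivisible_zero denselyDivisible_one denselyDivisible_succ_iff)

namespace Summit.Parity.GeneralizedHardyLittlewood.Theorems.Dhl42

/-! ### §0. The clause order of the tree's Definition 2.1 -/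

/-- The recursive clause of the tree's `DenselyDivisible` ([Polymath 8a, Definition 2.1(ii)]) with the
conjuncts inside `∃ q r` listed in the order `n = qr`, `q ∈ 𝒟^{(j)}`, `r ∈ 𝒟^{(l)}`, `R/y ≤ r ≤ R`
in which the proofs of this file destructure it (they are ported from the certificate package, whose
own copy of Definition 2.1 used that order); the tree's `denselyDivisible_succ_iff` lists
`R/y ≤ r ≤ R` first. -/
theorem denselyDivisible_succ_iff' (y : ℝ) (i n : ℕ) :
    DenselyDivisible y (i + 1) n ↔ ∀ j l : ℕ, j + l = i → ∀ R : ℝ, 1 ≤ R → R ≤ y * n →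
      ∃ q r : ℕ, n = q * r ∧ DenselyDivisible y j q ∧ DenselyDivisible y l r ∧
        R / y ≤ (r : ℝ) ∧ (r : ℝ) ≤ R := by
  rw [denselyDivisible_succ_iff]
  constructor
  · intro h j l hjl R hR1 hRy
    obtain ⟨q, r, hn, h1, h2, hq, hr⟩ := h j l hjl R hR1 hRy
    exact ⟨q, r, hn, hq, hr, h1, h2⟩
  · intro h j l hjl R hR1 hRy
    obtain ⟨q, r, hn, hq, hr, h1, h2⟩ := h j l hjl R hR1 hRy
    exact ⟨q, r, hn, h1, h2, hq, hr⟩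

/-! ### §1. Two degenerate cases of [8a, Definition 2.1] -/

/-- `0` is `i`-tuply `y`-densely divisible for every `i` (vacuously: there is no scale
`1 ≤ R ≤ y · 0`). -/
theorem denselyDivisible_zero_right (y : ℝ) : ∀ i : ℕ, DenselyDivisible y i 0
  | 0 => denselyDivisible_zero y 0
  | (i + 1) => by
      rw [denselyDivisible_succ_iff']
      intro j l _ R hR1 hRy
      simp only [Nat.cast_zero, mul_zero] at hRy
      linarith

/-! ### §2. The extension property `(E_l)` of the proof of Proposition 3.3, multiplicatively

Paper (proof of Prop. 3.3): *if `S ∈ 𝖣_l`, `v > max S`, and either `v ≤ c` or `Σ S ≥ l v − c`,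
then `S ∪ {v} ∈ 𝖣_l`*.  Under `p ↔ λ log p`, `R ↔ e^{ρ/λ}` this reads: if `m` is `l`-tuply
`y`-densely divisible and `a ≤ y` or `a ^ l ≤ y m`, then `m a` is `l`-tuply `y`-densely divisible.
We prove it in this multiplicative form, for an ARBITRARY natural number `a` (the paper only needs a
new prime `a ∤ m`; primality and coprimality play no role in the argument), by strong induction on
`l`, following the paper's two families of factorisations: `σ ↦ σ` (put `a` into the `q`-part) on
the scales `R ≤ y m / a^{j'}`, and `σ ↦ σ + v` (put `a` into the `r`-part) on the larger scales. -/
/-- **The extension step `(E_l)` of the proof of Proposition 3.3, multiplicative form**: for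
`y ≥ 1`, if `m` is `l`-tuply `y`-densely divisible and `a ≤ y` or `a ^ l ≤ y·m`, then `m·a` is
`l`-tuply `y`-densely divisible (any natural number `a`; see the section comment above for the two
families of factorisations). -/
theorem denselyDivisible_mul_of_extension {y : ℝ} (hy : 1 ≤ y) (l : ℕ) :
    ∀ (m a : ℕ), DenselyDivisible y l m → ((a : ℝ) ≤ y ∨ (a : ℝ) ^ l ≤ y * m) →
      DenselyDivisible y l (m * a) := by
  induction l using Nat.strong_induction_on with
  | _ l ih =>
  intro m a hm ha
  rcases l with _ | l
  · exact denselyDivisible_zero y _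
  rcases Nat.eq_zero_or_pos m with rfl | hm0
  · rw [zero_mul]; exact hm
  rcases Nat.eq_zero_or_pos a with rfl | ha0
  · rw [mul_zero]; exact denselyDivisible_zero_right y _
  have hy0 : (0 : ℝ) < y := by linarith
  have ha0' : (0 : ℝ) < a := by exact_mod_cast ha0
  have hm1' : (1 : ℝ) ≤ m := by exact_mod_cast hm0
  rw [denselyDivisible_succ_iff'] at hm ⊢
  intro j' l' hjl R hR1 hRy
  push_cast at hRy
  have hR0 : (0 : ℝ) < R := by linarith
  by_cases hay : (a : ℝ) ≤ y
  · -- `v ≤ c`: both ways of absorbing `a` are free; the net is `N ∪ (v + N)`.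
    by_cases hR : R ≤ y * m
    · obtain ⟨q, r, hqr, hq, hr, h1, h2⟩ := hm j' l' hjl R hR1 hR
      exact ⟨q * a, r, by rw [hqr]; ring, ih j' (by omega) q a hq (Or.inl hay), hr, h1, h2⟩
    · push Not at hR
      have hR1' : 1 ≤ R / a := by
        rw [le_div_iff₀ ha0', one_mul]
        have : (a : ℝ) ≤ y * m := by nlinarith
        linarith
      have hRy' : R / a ≤ y * m := by
        rw [div_le_iff₀ ha0']; linarith
      obtain ⟨q, r, hqr, hq, hr, h1, h2⟩ := hm j' l' hjl (R / a) hR1' hRy'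
      refine ⟨q, r * a, by rw [hqr]; ring, hq, ih l' (by omega) r a hr (Or.inl hay), ?_, ?_⟩
      · rw [div_right_comm, div_le_iff₀ ha0'] at h1
        push_cast; exact h1
      · push_cast; exact (le_div_iff₀ ha0').1 h2
  · -- `v > c`, so `Σ S ≥ l v − c`, i.e. `a ^ (l+1) ≤ y m`.
    have hal : (a : ℝ) ^ (l + 1) ≤ y * m := ha.resolve_left hay
    push Not at hay
    have ha1 : (1 : ℝ) ≤ a := by linarith
    have hj : (0 : ℝ) < (a : ℝ) ^ j' := pow_pos ha0' _
    by_cases hR : R * (a : ℝ) ^ j' ≤ y * m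
    · -- first family: scales `R ≤ y m / a^{j'}`; absorb `a` into the `q`-part.
      have hRm : R ≤ y * m := by
        have h1j : (1 : ℝ) ≤ (a : ℝ) ^ j' := one_le_pow₀ ha1
        nlinarith
      obtain ⟨q, r, hqr, hq, hr, h1, h2⟩ := hm j' l' hjl R hR1 hRm
      refine ⟨q * a, r, by rw [hqr]; ring, ih j' (by omega) q a hq (Or.inr ?_), hr, h1, h2⟩
      have hr0 : (0 : ℝ) < r := lt_of_lt_of_le (div_pos hR0 hy0) h1
      have hmqr : (m : ℝ) = q * r := by exact_mod_cast hqr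
      have key : (a : ℝ) ^ j' * r ≤ y * q * r := by
        calc (a : ℝ) ^ j' * r = r * (a : ℝ) ^ j' := by ring
          _ ≤ R * (a : ℝ) ^ j' := by gcongr
          _ ≤ y * m := hR
          _ = y * q * r := by rw [hmqr]; ring
      exact le_of_mul_le_mul_right key hr0
    · -- second family: scales `R > y m / a^{j'}`; absorb `a` into the `r`-part.
      push Not at hR
      have hpow : (a : ℝ) ^ l' * (a : ℝ) ^ (j' + 1) = (a : ℝ) ^ (l + 1) := by
        rw [← pow_add]; congr 1; omega
      have hj1 : (0 : ℝ) < (a : ℝ) ^ (j' + 1) := pow_pos ha0' _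
      have hR1' : 1 ≤ R / a := by
        rw [le_div_iff₀ ha0', one_mul]
        have h1 : (1 : ℝ) ≤ (a : ℝ) ^ l' := one_le_pow₀ ha1
        have : (a : ℝ) * (a : ℝ) ^ j' < R * (a : ℝ) ^ j' := by
          calc (a : ℝ) * (a : ℝ) ^ j' = 1 * (a : ℝ) ^ (j' + 1) := by ring
            _ ≤ (a : ℝ) ^ l' * (a : ℝ) ^ (j' + 1) := by gcongr
            _ = (a : ℝ) ^ (l + 1) := hpow
            _ ≤ y * m := hal
            _ < R * (a : ℝ) ^ j' := hR
        exact le_of_lt (lt_of_mul_lt_mul_right this hj.le)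
      have hRy' : R / a ≤ y * m := by
        rw [div_le_iff₀ ha0']; linarith
      obtain ⟨q, r, hqr, hq, hr, h1, h2⟩ := hm j' l' hjl (R / a) hR1' hRy'
      rw [div_right_comm, div_le_iff₀ ha0'] at h1
      -- h1 : R / y ≤ r * a
      refine ⟨q, r * a, by rw [hqr]; ring, hq, ih l' (by omega) r a hr (Or.inr ?_), ?_, ?_⟩
      · have hRa : R ≤ y * r * a := by
          have := (div_le_iff₀ hy0).1 h1
          linarith
        have key : (a : ℝ) ^ l' * (a : ℝ) ^ (j' + 1) < y * r * (a : ℝ) ^ (j' + 1) := by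
          calc (a : ℝ) ^ l' * (a : ℝ) ^ (j' + 1) = (a : ℝ) ^ (l + 1) := hpow
            _ ≤ y * m := hal
            _ < R * (a : ℝ) ^ j' := hR
            _ ≤ (y * r * a) * (a : ℝ) ^ j' := by gcongr
            _ = y * r * (a : ℝ) ^ (j' + 1) := by ring
        exact le_of_lt (lt_of_mul_lt_mul_right key hj1.le)
      · push_cast; exact h1
      · push_cast; exact (le_div_iff₀ ha0').1 h2

/-! ### §3. Proposition 3.3 and Lemma 3.1 (chain criterion), multiplicative form -/

/-- **Proposition 3.3, multiplicative form, for an arbitrary finite set of factors.**  If every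
element `a > y` of a finite set `s ⊂ ℕ` satisfies `a ^ i ≤ y · ∏_{b ∈ s, b < a} b`, then `∏ s` is
`i`-tuply `y`-densely divisible.  (Paper: the final induction `V_s = V_{s-1} ∪ {v_s}` over the
increasing enumeration, each step being `(E_i)`.) -/
theorem denselyDivisible_prod_of_chain {y : ℝ} (hy : 1 ≤ y) (i : ℕ) (s : Finset ℕ)
    (h : ∀ a ∈ s, y < a → (a : ℝ) ^ i ≤ y * ∏ b ∈ s.filter (· < a), (b : ℝ)) :
    DenselyDivisible y i (∏ a ∈ s, a) := by
  induction s using Finset.induction_on_max with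
  | empty => simpa using denselyDivisible_one y i
  | insert a s hlt ih =>
    have ha : a ∉ s := fun h' => lt_irrefl a (hlt a h')
    rw [Finset.prod_insert ha, mul_comm]
    apply denselyDivisible_mul_of_extension hy i _ a
    · apply ih
      intro b hb hyb
      have hfilt : (insert a s).filter (· < b) = s.filter (· < b) := by
        rw [Finset.filter_insert, if_neg (not_lt.mpr (hlt b hb).le)]
      have := h b (Finset.mem_insert_of_mem hb) hyb
      rwa [hfilt] at this
    · by_cases hya : y < a
      · right
        have := h a (Finset.mem_insert_self a s) hya
        have hfilt : (insert a s).filter (· < a) = s := by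
          rw [Finset.filter_insert, if_neg (lt_irrefl a)]
          exact Finset.filter_true_of_mem hlt
        rw [hfilt] at this
        push_cast
        exact this
      · left; exact not_lt.mp hya

/-- **Proposition 3.3 (multiplicative form).**  Let `y ≥ 1`, `i ≥ 0` and let `n` be squarefree.  If
every prime `p ∣ n` with `p > y` satisfies `p ^ i ≤ y · ∏_{q ∣ n prime, q < p} q` — this is the
condition `𝒞_i(c;0)`, `B_V(v) ≥ i v − c`, for `V = {λ log p : p ∣ n}`, `c = λ log y` — then `n` is
`i`-tuply `y`-densely divisible. -/
theorem denselyDivisible_of_chain {y : ℝ} (hy : 1 ≤ y) (i : ℕ) {n : ℕ} (hn : Squarefree n)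
    (h : ∀ p ∈ n.primeFactors, y < p →
      (p : ℝ) ^ i ≤ y * ∏ q ∈ n.primeFactors.filter (· < p), (q : ℝ)) :
    DenselyDivisible y i n := by
  have := denselyDivisible_prod_of_chain hy i n.primeFactors h
  rwa [Nat.prod_primeFactors_of_squarefree hn] at this

/-- **Lemma 3.1, necessity.**  If the squarefree `n` is (singly) `y`-densely divisible, then every
prime `p ∣ n` satisfies `p ≤ y · ∏_{q ∣ n prime, q < p} q`.  (Paper: if `p_j > y P`, a scale `R` with
`y P < R < p_j` is served by no divisor, every divisor `≤ R` being a product of primes `< p_j`.) -/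
theorem chain_of_denselyDivisible_one {y : ℝ} (hy : 1 ≤ y) {n : ℕ} (hn : Squarefree n)
    (hd : DenselyDivisible y 1 n) :
    ∀ p ∈ n.primeFactors, (p : ℝ) ≤ y * ∏ q ∈ n.primeFactors.filter (· < p), (q : ℝ) := by
  intro p hp
  by_contra hlt
  push Not at hlt
  set P : ℕ := ∏ q ∈ n.primeFactors.filter (· < p), q with hP
  have hPcast : (∏ q ∈ n.primeFactors.filter (· < p), (q : ℝ)) = (P : ℝ) := by
    rw [hP]; push_cast; rfl
  rw [hPcast] at hlt
  have hn0 : n ≠ 0 := hn.ne_zero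
  have hy0 : (0 : ℝ) < y := by linarith
  have hP1 : (1 : ℝ) ≤ P := by
    have : 0 < P := Finset.prod_pos fun q hq => Nat.pos_of_mem_primeFactors (Finset.mem_filter.1 hq).1
    exact_mod_cast this
  have hpn : (p : ℝ) ≤ n := by exact_mod_cast Nat.le_of_mem_primeFactors hp
  set R : ℝ := (y * P + p) / 2 with hR
  have hR1 : 1 ≤ R := by
    have : (1 : ℝ) ≤ y * P := by nlinarith
    rw [hR]; linarith
  have hRn : R ≤ y * n := by
    have : (p : ℝ) ≤ y * n := by nlinarith
    rw [hR]; linarith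
  rw [denselyDivisible_succ_iff'] at hd
  obtain ⟨q, r, hqr, -, -, h1, h2⟩ := hd 0 0 rfl R hR1 hRn
  have hrn : r ∣ n := Dvd.intro_left q hqr.symm
  have hr : Squarefree r := hn.squarefree_of_dvd hrn
  have hsub : r.primeFactors ⊆ n.primeFactors.filter (· < p) := by
    intro t ht
    rw [Finset.mem_filter]
    refine ⟨Nat.primeFactors_mono hrn hn0 ht, ?_⟩
    have htr : (t : ℝ) ≤ r := by exact_mod_cast Nat.le_of_mem_primeFactors ht
    have : (t : ℝ) < p := by rw [hR] at h2; linarith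
    exact_mod_cast this
  have hrP : r ≤ P := by
    rw [← Nat.prod_primeFactors_of_squarefree hr, hP]
    exact Finset.prod_le_prod_of_subset_of_one_le' hsub fun q hq _ =>
      (Nat.pos_of_mem_primeFactors (Finset.mem_filter.1 hq).1)
  have hrP' : (r : ℝ) ≤ P := by exact_mod_cast hrP
  rw [div_le_iff₀ hy0] at h1
  -- h1 : R ≤ r * y, but R > y P ≥ y r
  have : (r : ℝ) * y ≤ P * y := by gcongr
  rw [hR] at h1
  nlinarith

/-- **Lemma 3.1 (chain criterion).**  For `y ≥ 1` and squarefree `n` with prime factors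
`p_1 < ⋯ < p_r`: `n ∈ 𝒟^{(1)}(y)` iff `p_j ≤ y p_1 ⋯ p_{j-1}` for all `j`.  Sufficiency is the case
`i = 1` of Proposition 3.3 (the paper proves it by a direct induction; here it is the special case). -/
theorem denselyDivisible_one_iff_chain {y : ℝ} (hy : 1 ≤ y) {n : ℕ} (hn : Squarefree n) :
    DenselyDivisible y 1 n ↔
      ∀ p ∈ n.primeFactors, (p : ℝ) ≤ y * ∏ q ∈ n.primeFactors.filter (· < p), (q : ℝ) :=
  ⟨chain_of_denselyDivisible_one hy hn, fun h =>
    denselyDivisible_of_chain hy 1 hn fun p hp _ => by rw [pow_one]; exact h p hp⟩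

end Summit.Parity.GeneralizedHardyLittlewood.Theorems.Dhl42
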